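import Literature.AlgebraicGeometry.HodgeTheory.AbelianVarietyEndAlgebraCommutativeCriterion
import Literature.AlgebraicGeometry.HodgeTheory.AbelianVarietyProductOfSimplesSubvarieties
import Literature.AlgebraicGeometry.Motives.AbelianVarietyEndAlgebraProdOfHomEqZero
import HarnessLib

/-!
# Products of two abelian varieties: `B ⊞ B' ≅ ⨁ ![B, B']`, and the dichotomy for two simple factors — `B × B'` has exactly `4`
# abelian subvarieties and reduced `End` when `B ≁ B'`, infinitely many and non-reduced `End` when `B ∼ B'`
# (Mumford §19 Cor. 1–2; Zarhin 2008 Thm. 3.2)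

Layer `Literature/AlgebraicGeometry/HodgeTheory`; theorems only (no `def`, no instance, no named fact; net debt 0).  The tree states
facts about two-factor products sometimes for the binary biproduct `B ⊞ B'` (`…SubvarietiesFiniteCriterion`,
`…EndAlgebraReducedIffEndReduced`) and sometimes for the `Fin 2`-indexed biproduct `⨁ ![B, B']` (`…ProductOfSimplesSubvarieties`,
the shape used for `E × T ∼ ⨁ ![E, T]` downstream).  §1 provides the TRANSFER `B ⊞ B' ≅ ⨁ ![B, B']` (explicit isomorphism with
`hom = desc (ι 0) (ι 1)`, `inv = lift (π 0) (π 1)`; any preadditive category with finite biproducts — here abelian varieties over any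
field) and moves each statement to the other shape.  §2 (any field ∕ perfect field as marked) is the DICHOTOMY for simple `B`, `B'` of
positive dimension: `B ≁ B'` ⟹ `End⁰(B × B') ≅ End⁰ B × End⁰ B'` reduced, exactly four abelian subvarieties `0`, `B`, `B'`, `B × B'`;
`B ∼ B'` ⟹ `End⁰(B × B') ≅ M_2(End⁰ B)` non-reduced, infinitely many abelian subvarieties (graphs of isogenies); in particular for
two elliptic curves.

THE PRINT.  Mumford, *Abelian Varieties* (1970) §19 Cor. 1–2 of Thm. 1 (pp. 173–174); Zarhin 2008 Thm. 3.2 (p. 7; Lenstra–Oort–Zarhin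
1996); Milne, *Abelian Varieties* (1986) §12 p. 122 (PDF p. 189); Lange–Rodríguez, *Decomposition of Jacobians by Prym Varieties*
(2022) §2.9 (PDF p. 44).

Results (namespace `Literature.AlgebraicGeometry.HodgeTheory.AbelianVariety`):
* §1 (any field) **`exists_biprod_iso_biproduct_pair`** (`e : B ⊞ B' ≅ ⨁ ![B, B']` with its two formulas), `isIsogenous_biprod_biproduct_pair`,
  `isIsogenous_biproduct_pair_biprod`, `infinite_setOf_range_subvariety_biproduct_pair_of_isIsogenous` (`⨁ ![B, B']`, `B ∼ B'`),
  `not_isReduced_end_biproduct_pair_of_isIsogenous`, `not_isReduced_endAlgebra_biproduct_pair_of_isIsogenous`,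
  **`isReduced_endAlgebra_biprod_of_hom_eq_zero`** (`Hom(B, B') = Hom(B', B) = 0` and `End⁰ B`, `End⁰ B'` reduced ⟹ `End⁰(B ⊞ B')`
  reduced), `endAlgebra_comm_biprod_iff_of_hom_eq_zero`;
* §2 (perfect field; `B`, `B'` simple of positive dimension) `isReduced_end_biprod_of_not_isIsogenous`,
  **`isReduced_end_biprod_iff_not_isIsogenous`**, `isReduced_endAlgebra_biprod_iff_not_isIsogenous`,
  **`finite_setOf_range_subvariety_biprod_iff_not_isIsogenous`**, `infinite_setOf_range_subvariety_biprod_iff_isIsogenous`,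
  `natCard_setOf_range_subvariety_biprod_of_not_isIsogenous` (`= 4`), **`natCard_setOf_range_subvariety_biprod_eq_four_iff`**,
  **`end_comm_biprod_iff`** (`End(B ⊞ B')` commutative ⟺ `B ≁ B'` and `End B`, `End B'` commutative),
  `natCard_setOf_range_subvariety_biprod_eq_four_iff_of_dim_eq_one` (two elliptic curves: `E × E'` has exactly `4` abelian
  subvarieties iff `E ≁ E'`).

## References
* [MumfordAV1970] D. Mumford, *Abelian Varieties* (1970), §19 Thm. 1, Cor. 1–2, Thm. 3 (pp. 173–176).
* [Zarhin2008HomomorphismsFiniteFields] Yu. G. Zarhin, *Homomorphisms of abelian varieties over finite fields* (2008)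
  (arXiv:0711.1615), Thm. 3.2 (p. 7).
* [Milne1986AbelianVarieties] J. S. Milne, *Abelian Varieties*, in Cornell–Silverman (1986), §12 p. 122 (PDF p. 189).
* [LangeRodriguez2022] H. Lange, R. E. Rodríguez, LNM 2310 (2022), §2.9 (PDF p. 44).
-/

noncomputable section

universe u

open CategoryTheory CategoryTheory.Limits

namespace Literature.AlgebraicGeometry.HodgeTheory

namespace AbelianVariety

open _root_.AlgebraicGeometry
open Literature.AlgebraicGeometry.Motives Literature.AlgebraicGeometry.Motives.AbelianVariety

variable {K : Type u} [Field K]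

/-! ## §1 The transfer `B ⊞ B' ≅ ⨁ ![B, B']` (any field) -/

section Transfer

variable (B B' : Motives.AbelianVariety K)

/-- **`B ⊞ B' ≅ ⨁ ![B, B']`**: the isomorphism `desc (ι 0) (ι 1)` with inverse `lift (π 0) (π 1)` between the binary biproduct and the
`Fin 2`-indexed biproduct. [cite: MumfordAV1970, §19 Thm. 1 (p. 173: products of abelian varieties)] -/
theorem exists_biprod_iso_biproduct_pair :
    ∃ e : B ⊞ B' ≅ ⨁ ![B, B'], e.hom = biprod.desc (biproduct.ι ![B, B'] 0) (biproduct.ι ![B, B'] 1) ∧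
      e.inv = biprod.lift (biproduct.π ![B, B'] 0) (biproduct.π ![B, B'] 1) := by
  have h00 : biproduct.ι ![B, B'] 0 ≫ biproduct.π ![B, B'] 0 = 𝟙 _ := biproduct.ι_π_self _ _
  have h11 : biproduct.ι ![B, B'] 1 ≫ biproduct.π ![B, B'] 1 = 𝟙 _ := biproduct.ι_π_self _ _
  have h01 : biproduct.ι ![B, B'] 0 ≫ biproduct.π ![B, B'] 1 = 0 := biproduct.ι_π_ne _ (by decide)
  have h10 : biproduct.ι ![B, B'] 1 ≫ biproduct.π ![B, B'] 0 = 0 := biproduct.ι_π_ne _ (by decide)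
  refine ⟨⟨biprod.desc (biproduct.ι ![B, B'] 0) (biproduct.ι ![B, B'] 1),
    biprod.lift (biproduct.π ![B, B'] 0) (biproduct.π ![B, B'] 1), ?_, ?_⟩, rfl, rfl⟩
  · refine biprod.hom_ext' _ _ (biprod.hom_ext _ _ ?_ ?_) (biprod.hom_ext _ _ ?_ ?_)
    · rw [biprod.inl_desc_assoc, Category.assoc, biprod.lift_fst, Category.comp_id, biprod.inl_fst]
      exact h00
    · rw [biprod.inl_desc_assoc, Category.assoc, biprod.lift_snd, Category.comp_id, biprod.inl_snd]
      exact h01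
    · rw [biprod.inr_desc_assoc, Category.assoc, biprod.lift_fst, Category.comp_id, biprod.inr_fst]
      exact h10
    · rw [biprod.inr_desc_assoc, Category.assoc, biprod.lift_snd, Category.comp_id, biprod.inr_snd]
      exact h11
  · rw [biprod.lift_desc, ← biproduct.total, Fin.sum_univ_two]
    rfl

/-- `B ⊞ B' ∼ ⨁ ![B, B']` (they are isomorphic). [cite: MumfordAV1970, §19 Thm. 1 (p. 173)] -/
theorem isIsogenous_biprod_biproduct_pair : IsIsogenous (B ⊞ B') (⨁ ![B, B']) := by
  obtain ⟨e, -, -⟩ := exists_biprod_iso_biproduct_pair B B'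
  exact ⟨e.hom, isIsogeny_hom_of_iso e⟩

/-- `⨁ ![B, B'] ∼ B ⊞ B'`. [cite: MumfordAV1970, §19 Thm. 1 (p. 173)] -/
theorem isIsogenous_biproduct_pair_biprod : IsIsogenous (⨁ ![B, B']) (B ⊞ B') := by
  obtain ⟨e, -, -⟩ := exists_biprod_iso_biproduct_pair B B'
  exact ⟨e.inv, isIsogeny_hom_of_iso e.symm⟩

variable {B B'}

/-- **`⨁ ![B, B']` with `B ∼ B'`, `0 < dim B` has infinitely many abelian subvarieties** (any field): it receives the finite
`B ⊞ B → B ⊞ B' ≅ ⨁ ![B, B']`. [cite: Zarhin2008HomomorphismsFiniteFields, Thm. 3.2 (p. 7)] [cite: MumfordAV1970, §19 Cor. 1–2 of Thm. 1 (pp. 173–174)] -/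
theorem infinite_setOf_range_subvariety_biproduct_pair_of_isIsogenous (h : IsIsogenous B B') (hB : 0 < B.dim) :
    {R : Set (⨁ ![B, B']).X.left | ∃ (Z : Motives.AbelianVariety K) (j : Z ⟶ ⨁ ![B, B']),
        IsClosedImmersion (Hom.toSchemeHom j) ∧ R = Set.range (Hom.toSchemeHom j)}.Infinite := by
  obtain ⟨f, hf⟩ := h
  obtain ⟨e, -, -⟩ := exists_biprod_iso_biproduct_pair B B'
  haveI : IsFinite (Hom.toSchemeHom (biprod.map (𝟙 B) f)) := ((isIsogeny_id B).biprod_map hf).2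
  haveI : IsFinite (Hom.toSchemeHom e.hom) := (isIsogeny_hom_of_iso e).2
  haveI := isFinite_toSchemeHom_comp (biprod.map (𝟙 B) f) e.hom
  exact infinite_setOf_range_subvariety_of_isFinite_biprod (biprod.map (𝟙 B) f ≫ e.hom) hB

/-- `End(⨁ ![B, B'])` is not reduced for `B ∼ B'`, `0 < dim B` (any field). [cite: MumfordAV1970, §19 Cor. 2 of Thm. 1 (p. 174)] -/
theorem not_isReduced_end_biproduct_pair_of_isIsogenous (h : IsIsogenous B B') (hB : 0 < B.dim) :
    ¬ _root_.IsReduced (End (⨁ ![B, B'])) := by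
  rw [← isReduced_end_iff_of_isIsogenous (isIsogenous_biprod_biproduct_pair B B')]
  exact not_isReduced_end_biprod_of_isIsogenous h hB

/-- `End⁰(⨁ ![B, B'])` is not reduced for `B ∼ B'`, `0 < dim B` (any field). [cite: MumfordAV1970, §19 Cor. 2 of Thm. 1 (p. 174)] -/
theorem not_isReduced_endAlgebra_biproduct_pair_of_isIsogenous (h : IsIsogenous B B') (hB : 0 < B.dim) :
    ¬ IsReduced (⨁ ![B, B']).endAlgebra := by
  rw [isReduced_endAlgebra_iff_isReduced_end]
  exact not_isReduced_end_biproduct_pair_of_isIsogenous h hB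

/-- **`Hom(B, B') = Hom(B', B) = 0` with `End⁰ B`, `End⁰ B'` reduced ⟹ `End⁰(B ⊞ B')` reduced** (any field:
`End⁰(B ⊞ B') ≅ End⁰ B × End⁰ B'`). [cite: MumfordAV1970, §19 Cor. 2 of Thm. 1 (p. 174)] -/
theorem isReduced_endAlgebra_biprod_of_hom_eq_zero (hBB' : ∀ f : B ⟶ B', f = 0) (hB'B : ∀ g : B' ⟶ B, g = 0)
    [IsReduced B.endAlgebra] [IsReduced B'.endAlgebra] : IsReduced (B ⊞ B').endAlgebra := by
  obtain ⟨e⟩ := nonempty_algEquiv_endAlgebra_biprod_prod hBB' hB'B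
  exact isReduced_of_injective e.toRingEquiv e.toRingEquiv.injective

/-- With `Hom(B, B') = Hom(B', B) = 0`: `End⁰(B ⊞ B')` is commutative iff `End⁰ B` and `End⁰ B'` are (any field).
[cite: MumfordAV1970, §19 Cor. 2 of Thm. 1 (p. 174)] -/
theorem endAlgebra_comm_biprod_iff_of_hom_eq_zero (hBB' : ∀ f : B ⟶ B', f = 0) (hB'B : ∀ g : B' ⟶ B, g = 0) :
    (∀ x y : (B ⊞ B').endAlgebra, x * y = y * x) ↔
      (∀ x y : B.endAlgebra, x * y = y * x) ∧ ∀ x y : B'.endAlgebra, x * y = y * x := by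
  obtain ⟨e⟩ := nonempty_algEquiv_endAlgebra_biprod_prod hBB' hB'B
  constructor
  · intro h
    refine ⟨fun x y ↦ ?_, fun x y ↦ ?_⟩
    · have hx := h (e.symm (x, 1)) (e.symm (y, 1))
      rw [← map_mul, ← map_mul, e.symm.injective.eq_iff, Prod.mk_mul_mk, Prod.mk_mul_mk, one_mul] at hx
      exact (Prod.mk.inj hx).1
    · have hx := h (e.symm (1, x)) (e.symm (1, y))
      rw [← map_mul, ← map_mul, e.symm.injective.eq_iff, Prod.mk_mul_mk, Prod.mk_mul_mk, one_mul] at hx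
      exact (Prod.mk.inj hx).2
  · rintro ⟨h, h'⟩ x y
    apply e.injective
    rw [map_mul, map_mul, Prod.ext_iff]
    exact ⟨h _ _, h' _ _⟩

end Transfer

/-! ## §2 Two simple factors: the dichotomy (perfect field) -/

section Dichotomy

variable [PerfectField K] {B B' : Motives.AbelianVariety K}

/-- `B ≁ B'` simple of positive dimension ⟹ `End(B ⊞ B')` reduced (perfect field; `Hom(B, B') = Hom(B', B) = 0`).
[cite: MumfordAV1970, §19 Cor. 2 of Thm. 1 (p. 174)] [cite: Milne1986AbelianVarieties, §12 p. 122 (PDF p. 189)] -/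
theorem isReduced_end_biprod_of_not_isIsogenous (hB : B.IsSimple) (hB' : B'.IsSimple) (hne : ¬ IsIsogenous B B') :
    _root_.IsReduced (End (B ⊞ B')) := by
  haveI := Literature.AlgebraicGeometry.ComplexMultiplication.isReduced_endAlgebra_of_isSimple hB
  haveI := Literature.AlgebraicGeometry.ComplexMultiplication.isReduced_endAlgebra_of_isSimple hB'
  exact isReduced_endAlgebra_iff_isReduced_end.1 (isReduced_endAlgebra_biprod_of_hom_eq_zero
    (fun f ↦ hom_eq_zero_of_isSimple_of_not_isIsogenous_of_perfectField hB hB' hne f)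
    (fun g ↦ hom_eq_zero_of_isSimple_of_not_isIsogenous_of_perfectField hB' hB (fun h ↦ hne h.symm') g))

/-- **`End(B ⊞ B')` IS REDUCED IFF `B ≁ B'`** for simple `B`, `B'` of positive dimension (perfect field).
[cite: MumfordAV1970, §19 Cor. 2 of Thm. 1 (p. 174)] -/
theorem isReduced_end_biprod_iff_not_isIsogenous (hB : B.IsSimple) (hB' : B'.IsSimple) (hB0 : 0 < B.dim) :
    _root_.IsReduced (End (B ⊞ B')) ↔ ¬ IsIsogenous B B' :=
  ⟨fun hR h ↦ not_isReduced_end_biprod_of_isIsogenous h hB0 hR, isReduced_end_biprod_of_not_isIsogenous hB hB'⟩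

/-- `End⁰(B ⊞ B')` is reduced iff `B ≁ B'` (simple factors of positive dimension, perfect field). [cite: MumfordAV1970, §19 Cor. 2 of Thm. 1 (p. 174)] -/
theorem isReduced_endAlgebra_biprod_iff_not_isIsogenous (hB : B.IsSimple) (hB' : B'.IsSimple) (hB0 : 0 < B.dim) :
    IsReduced (B ⊞ B').endAlgebra ↔ ¬ IsIsogenous B B' := by
  rw [isReduced_endAlgebra_iff_isReduced_end, isReduced_end_biprod_iff_not_isIsogenous hB hB' hB0]

/-- **`B ⊞ B'` HAS FINITELY MANY ABELIAN SUBVARIETIES IFF `B ≁ B'`** (simple factors of positive dimension, perfect field).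
[cite: Zarhin2008HomomorphismsFiniteFields, Thm. 3.2 (p. 7)] [cite: MumfordAV1970, §19 Cor. 1–2 of Thm. 1 (pp. 173–174)] -/
theorem finite_setOf_range_subvariety_biprod_iff_not_isIsogenous (hB : B.IsSimple) (hB' : B'.IsSimple) (hB0 : 0 < B.dim) :
    {R : Set (B ⊞ B').X.left | ∃ (Z : Motives.AbelianVariety K) (j : Z ⟶ B ⊞ B'),
        IsClosedImmersion (Hom.toSchemeHom j) ∧ R = Set.range (Hom.toSchemeHom j)}.Finite ↔ ¬ IsIsogenous B B' := by
  rw [finite_setOf_range_subvariety_iff_isReduced_end, isReduced_end_biprod_iff_not_isIsogenous hB hB' hB0]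

/-- … and infinitely many iff `B ∼ B'`. [cite: Zarhin2008HomomorphismsFiniteFields, Thm. 3.2 (p. 7)] -/
theorem infinite_setOf_range_subvariety_biprod_iff_isIsogenous (hB : B.IsSimple) (hB' : B'.IsSimple) (hB0 : 0 < B.dim) :
    {R : Set (B ⊞ B').X.left | ∃ (Z : Motives.AbelianVariety K) (j : Z ⟶ B ⊞ B'),
        IsClosedImmersion (Hom.toSchemeHom j) ∧ R = Set.range (Hom.toSchemeHom j)}.Infinite ↔ IsIsogenous B B' := by
  rw [Set.Infinite, finite_setOf_range_subvariety_biprod_iff_not_isIsogenous hB hB' hB0, not_not]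

/-- `B ⊞ B'` with `B ≁ B'` simple of positive dimension has exactly FOUR abelian subvarieties (perfect field; transferred from
`…ProductOfSimplesSubvarieties.natCard_setOf_range_subvariety_pair` along `B ⊞ B' ≅ ⨁ ![B, B']`).
[cite: MumfordAV1970, §19 Cor. 1–2 of Thm. 1 (pp. 173–174)] [cite: Zarhin2008HomomorphismsFiniteFields, Thm. 3.2 (p. 7)] -/
theorem natCard_setOf_range_subvariety_biprod_of_not_isIsogenous (hB : B.IsSimple) (hB' : B'.IsSimple) (hB0 : 0 < B.dim)
    (hB0' : 0 < B'.dim) (hne : ¬ IsIsogenous B B') :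
    Nat.card {R : Set (B ⊞ B').X.left | ∃ (Z : Motives.AbelianVariety K) (j : Z ⟶ B ⊞ B'),
        IsClosedImmersion (Hom.toSchemeHom j) ∧ R = Set.range (Hom.toSchemeHom j)} = 4 := by
  rw [natCard_setOf_range_subvariety_eq_of_isIsogenous (isIsogenous_biprod_biproduct_pair B B')]
  exact natCard_setOf_range_subvariety_pair hB hB' hB0 hB0' hne

/-- **DICHOTOMY: `B ⊞ B'` (simple factors of positive dimension) HAS EXACTLY FOUR ABELIAN SUBVARIETIES IFF `B ≁ B'`**, and infinitely
many otherwise (perfect field). [cite: MumfordAV1970, §19 Cor. 1–2 of Thm. 1 (pp. 173–174)] [cite: Zarhin2008HomomorphismsFiniteFields, Thm. 3.2 (p. 7)] -/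
theorem natCard_setOf_range_subvariety_biprod_eq_four_iff (hB : B.IsSimple) (hB' : B'.IsSimple) (hB0 : 0 < B.dim)
    (hB0' : 0 < B'.dim) :
    Nat.card {R : Set (B ⊞ B').X.left | ∃ (Z : Motives.AbelianVariety K) (j : Z ⟶ B ⊞ B'),
        IsClosedImmersion (Hom.toSchemeHom j) ∧ R = Set.range (Hom.toSchemeHom j)} = 4 ↔ ¬ IsIsogenous B B' := by
  refine ⟨fun h4 h ↦ ?_, natCard_setOf_range_subvariety_biprod_of_not_isIsogenous hB hB' hB0 hB0'⟩
  rw [Set.Infinite.card_eq_zero (infinite_setOf_range_subvariety_biprod_of_isIsogenous h hB0)] at h4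
  exact absurd h4 (by decide)

/-- **`End(B ⊞ B')` IS COMMUTATIVE IFF `B ≁ B'` AND `End B`, `End B'` ARE COMMUTATIVE** (simple factors of positive dimension,
perfect field): `End⁰(B ⊞ B')` is `End⁰ B × End⁰ B'` or `M_2(End⁰ B)`. [cite: MumfordAV1970, §19 Cor. 2 of Thm. 1 (p. 174)] -/
theorem end_comm_biprod_iff (hB : B.IsSimple) (hB' : B'.IsSimple) (hB0 : 0 < B.dim) :
    (∀ φ ψ : B ⊞ B' ⟶ B ⊞ B', φ ≫ ψ = ψ ≫ φ) ↔
      ¬ IsIsogenous B B' ∧ (∀ φ ψ : B ⟶ B, φ ≫ ψ = ψ ≫ φ) ∧ ∀ φ ψ : B' ⟶ B', φ ≫ ψ = ψ ≫ φ := by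
  have key : ¬ IsIsogenous B B' → ((∀ φ ψ : B ⊞ B' ⟶ B ⊞ B', φ ≫ ψ = ψ ≫ φ) ↔
      (∀ φ ψ : B ⟶ B, φ ≫ ψ = ψ ≫ φ) ∧ ∀ φ ψ : B' ⟶ B', φ ≫ ψ = ψ ≫ φ) := fun hne ↦ by
    rw [← endAlgebra_comm_iff_end_comm, ← endAlgebra_comm_iff_end_comm, ← endAlgebra_comm_iff_end_comm]
    exact endAlgebra_comm_biprod_iff_of_hom_eq_zero
      (fun f ↦ hom_eq_zero_of_isSimple_of_not_isIsogenous_of_perfectField hB hB' hne f)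
      (fun g ↦ hom_eq_zero_of_isSimple_of_not_isIsogenous_of_perfectField hB' hB (fun h ↦ hne h.symm') g)
  constructor
  · intro h
    have hne : ¬ IsIsogenous B B' :=
      (isReduced_end_biprod_iff_not_isIsogenous hB hB' hB0).1 (isReduced_end_of_forall_comm _ h)
    exact ⟨hne, (key hne).1 h⟩
  · rintro ⟨hne, h⟩
    exact (key hne).2 h

/-- **TWO ELLIPTIC CURVES: `E ⊞ E'` (`dim E = dim E' = 1`) has exactly four abelian subvarieties iff `E ≁ E'`**, infinitely many iff
`E ∼ E'` (perfect field; curves are simple). [cite: MumfordAV1970, §19 Cor. 1–2 of Thm. 1 (pp. 173–174)] [cite: Zarhin2008HomomorphismsFiniteFields, Thm. 3.2 (p. 7)] -/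
theorem natCard_setOf_range_subvariety_biprod_eq_four_iff_of_dim_eq_one (hE : B.dim = 1) (hE' : B'.dim = 1) :
    Nat.card {R : Set (B ⊞ B').X.left | ∃ (Z : Motives.AbelianVariety K) (j : Z ⟶ B ⊞ B'),
        IsClosedImmersion (Hom.toSchemeHom j) ∧ R = Set.range (Hom.toSchemeHom j)} = 4 ↔ ¬ IsIsogenous B B' :=
  natCard_setOf_range_subvariety_biprod_eq_four_iff (isSimple_of_dim_le_one hE.le) (isSimple_of_dim_le_one hE'.le)
    (by omega) (by omega)

end Dichotomy

end AbelianVariety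

end Literature.AlgebraicGeometry.HodgeTheory

end
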